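import Summits.QuantumFields.GaugeBoot.LoopEquation
import Literature.MathematicalPhysics.QuantumLattice.SU2Haar
import HarnessLib

/-!
# Loop-equation instances: the plaquette row (1eq) and the spur-plaquette row (2eq) (cell `gauge-boot`, L1, instances)

Honest framing (cell rule): certified bounds on lattice expectations at stated coupling, gauge group, dimension and
torus size; NOT a mass gap, NOT a continuum limit, NOT a string tension; not summit-bearing
(`FixedCouplingUltralocality`, `PerturbativeInvisibility`).

Instances of `LoopEquation.lean` obtained by EVALUATING the split terms of concrete marked words (the plaquette terms
`plaqTerm` are explicit by definition):
* `sum_splitTerm_plaquette`: for `P = +μ +ν −μ −ν` only the marked letter traverses the edge `(x, μ)`: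
  `Σ_k splitTerm_k = (N − s/N)·tr ρ(U_P)` (any `d`, `L ≥ 2`, i.e. `(1 : ZMod L) ≠ 0`);
* `sum_splitTerm_spurPlaquette`: for `w = +μ +μ +ν −μ −ν −μ` the forward (first) and backward (last) traversals cancel:
  `Σ_k splitTerm_k = 0`;
* the rows: `loopEquation_plaquette` / `loopEquation_spurPlaquette` (abstract `r`, `s`), and in `d = 2` for `SU(N)`
  (`oneEq_specialUnitaryGroup`, `twoEq_specialUnitaryGroup`), `U(N)` (`oneEq_unitaryGroup`, `twoEq_unitaryGroup`) and,
  fully explicit in single traces, `SU(2)` (`oneEq_su_two`, using `star_trace_su_two` (tree `su2_apply_11`):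
  `tr U⁻¹ = tr U` on `SU(2)`, whence `plaqTerm_su_two`), and in the cell's REAL loop variables
  `E_w = ⟨(1/2) Re tr U_w⟩` (= `wilsonExpectation (suRep 2) β (wordLoop (suRep 2) x w)` of `GaugeBoot/WordLoop.lean`,
  written out so that this file does not depend on it): `oneEq_su_two_real`, `twoEq_su_two_real` — the hypotheses
  `h1eq`/`h2eq` of lean1's kernel replay of certificate C1, up to the word-canonicalisation of `GaugeBoot/LoopClasses`.
These are the two loop equations (1eq), (2eq) of Kazakov–Zheng's `d = 2` six-variable system (arXiv:2404.16925 §2.2,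
printed optimum `0.75755` for `SU(2)` at `λ = 2`), re-derived in the cell's F0-SPEC.md / SIXVAR-S01.md / MM-DERIVATION
§5: in the loop variables `u, D, R, B, F±` (`W = ½tr`), `(3/4)λu + D − 1 + B − R = 0` and `R − B − F₊ + F₋ = 0`
(`SU(2)`), `λu + D − 1 + B − R = 0` (`U(N)`).  The identification of the 8- and 10-letter words below with the
canonical classes `D, R, B, F±` (cyclic backtrack reduction, lattice symmetry) is the generators' canonicalisation and
is recorded in the docstrings only.  Everything is `[folklore]`.
-/

noncomputable section

open MeasureTheory Filter Topology NormedSpace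
open scoped Matrix.Norms.Frobenius Matrix
open Literature.MathematicalPhysics.QuantumFieldTheory
open Summit.QuantumFields.YangMills.Cruxes.CurvatureAmnesia.WardDefect.SchwingerDyson

namespace Summit.QuantumFields.GaugeBoot

variable {d L N : ℕ} {G : Type} [Group G] {ρ : G →* Matrix (Fin N) (Fin N) ℂ}

section Instances

/-- `L ≥ 2` in the form used below: `(1 : ZMod L) ≠ 0`. [folklore] -/
theorem zmod_one_ne_zero (hL : 1 < L) : (1 : ZMod L) ≠ 0 := by
  haveI : Fact (1 < L) := ⟨hL⟩
  exact one_ne_zero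

/-- On a torus with `L ≥ 2` a unit shift moves every site. [folklore] -/
theorem shift_ne_self [NeZero L] (hL : (1 : ZMod L) ≠ 0) (x : Site d L) (i : Fin d) : x.shift i ≠ x := by
  intro h
  have h' := congrFun h i
  simp [Site.shift] at h'
  exact hL h'

/-- `x + e_i + e_j ≠ x` when `i ≠ j` and `L ≥ 2`. [folklore] -/
theorem shift_shift_ne_self [NeZero L] (hL : (1 : ZMod L) ≠ 0) (x : Site d L) {i j : Fin d} (hij : i ≠ j) :
    (x.shift i).shift j ≠ x := by
  intro h
  have h' := congrFun h i
  simp [Site.shift, hij] at h'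
  exact hL h'

variable (ρ) in
/-- **Split terms of the plaquette word** `P = +μ +ν −μ −ν` (`μ ≠ ν`, `L ≥ 2`) for the edge `(x, μ)`: only the marked
first letter traverses the edge, contributing `(N − s/N)·tr ρ(U_P)` (`tr 1 = N` for the empty prefix). [folklore] -/
theorem sum_splitTerm_plaquette [NeZero L] (hL : (1 : ZMod L) ≠ 0) (s : ℂ) (x : Site d L) {μ ν : Fin d}
    (hμν : μ ≠ ν) (U : GaugeConfig d L G) :
    ∑ k ∈ Finset.range (Word.plaquette μ ν).length, splitTerm ρ s x μ U (Word.plaquette μ ν) k =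
      ((N : ℂ) - s / N) * (ρ (wordHolonomy U x (Word.plaquette μ ν))).trace := by
  have hν : x.shift ν ≠ x := shift_ne_self hL x ν
  simp only [Word.length_plaquette, Finset.sum_range_succ, Finset.sum_range_zero, zero_add]
  have h0 : splitTerm ρ s x μ U (Word.plaquette μ ν) 0 = ((N : ℂ) - s / N) * (ρ (wordHolonomy U x (Word.plaquette μ ν))).trace := by
    unfold splitTerm
    simp only [Word.plaquette, List.getElem?_cons_zero, Word.siteAt_zero, Step.edge_fwd, if_true, Step.isFwd_fwd,
      List.take_zero, wordHolonomy_nil, map_one, Matrix.trace_one, Fintype.card_fin, List.drop_zero]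
    ring
  have h1 : splitTerm ρ s x μ U (Word.plaquette μ ν) 1 = 0 := by
    unfold splitTerm
    simp [Word.plaquette, Word.siteAt, Word.endpoint, hμν.symm]
  have h2 : splitTerm ρ s x μ U (Word.plaquette μ ν) 2 = 0 := by
    unfold splitTerm
    simp [Word.plaquette, Word.siteAt, Word.endpoint, shift_shift_sub, hν]
  have h3 : splitTerm ρ s x μ U (Word.plaquette μ ν) 3 = 0 := by
    unfold splitTerm
    simp [Word.plaquette, Word.siteAt, Word.endpoint, hμν.symm]
  rw [h0, h1, h2, h3]
  ring


/-- The SPUR-PLAQUETTE word `+μ +μ +ν −μ −ν −μ` (go along `e`, once more along `μ`, around the plaquette there, back):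
the marked word of KZ2024's second six-variable equation (2eq) (cell F0-SPEC.md §3, MM-DERIVATION §5). [folklore] -/
def Word.spurPlaquette (μ ν : Fin d) : Word d := [.fwd μ, .fwd μ, .fwd ν, .bwd μ, .bwd ν, .bwd μ]

/-- Unfolding lemma `Word.length_spurPlaquette`. [folklore] -/
@[simp] theorem Word.length_spurPlaquette (μ ν : Fin d) : (Word.spurPlaquette μ ν).length = 6 := rfl

/-- The spur-plaquette word is closed. [folklore] -/
@[simp] theorem endpoint_spurPlaquette (x : Site d L) (μ ν : Fin d) :
    Word.endpoint x (Word.spurPlaquette μ ν) = x := by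
  simp only [Word.spurPlaquette, Word.endpoint_cons, Word.endpoint_nil, Step.apply, Site.shift]
  abel

variable (ρ) in
/-- **Split terms of the spur-plaquette word** for the edge `(x, μ)` (`μ ≠ ν`, `L ≥ 2`): the edge is traversed forward by
the first letter and backward by the last; the two split terms `(N − s/N)tr ρ(U_w)` cancel — the row (2eq) has no
`A_id/A_split/A_join` part ("no λ, no constant", MM-DERIVATION §5). [folklore] -/
theorem sum_splitTerm_spurPlaquette [NeZero L] (hL : (1 : ZMod L) ≠ 0) (s : ℂ) (x : Site d L) {μ ν : Fin d}
    (hμν : μ ≠ ν) (U : GaugeConfig d L G) :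
    ∑ k ∈ Finset.range (Word.spurPlaquette μ ν).length, splitTerm ρ s x μ U (Word.spurPlaquette μ ν) k = 0 := by
  have hμ : x.shift μ ≠ x := shift_ne_self hL x μ
  have hμν' : (x.shift μ).shift ν ≠ x := shift_shift_ne_self hL x hμν
  have hs3 : ((x.shift μ).shift μ).shift ν - Pi.single μ 1 = (x.shift μ).shift ν := by
    simp only [Site.shift]; abel
  have hs5 : ((x.shift μ).shift μ).shift ν - Pi.single μ 1 - Pi.single ν 1 - Pi.single μ 1 = x := by
    simp only [Site.shift]; abel
  have hs6 : ((x.shift μ).shift μ).shift ν - Pi.single μ 1 - Pi.single ν 1 - Pi.single μ 1 = x := hs5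
  simp only [Word.length_spurPlaquette, Finset.sum_range_succ, Finset.sum_range_zero, zero_add]
  have h0 : splitTerm ρ s x μ U (Word.spurPlaquette μ ν) 0 =
      ((N : ℂ) - s / N) * (ρ (wordHolonomy U x (Word.spurPlaquette μ ν))).trace := by
    unfold splitTerm
    simp only [Word.spurPlaquette, List.getElem?_cons_zero, Word.siteAt_zero, Step.edge_fwd, if_true,
      Step.isFwd_fwd, List.take_zero, wordHolonomy_nil, map_one, Matrix.trace_one, Fintype.card_fin, List.drop_zero]
    ring
  have h1 : splitTerm ρ s x μ U (Word.spurPlaquette μ ν) 1 = 0 := by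
    unfold splitTerm
    simp [Word.spurPlaquette, Word.siteAt, Word.endpoint, hμ]
  have h2 : splitTerm ρ s x μ U (Word.spurPlaquette μ ν) 2 = 0 := by
    unfold splitTerm
    simp [Word.spurPlaquette, Word.siteAt, Word.endpoint, hμν.symm]
  have h3 : splitTerm ρ s x μ U (Word.spurPlaquette μ ν) 3 = 0 := by
    unfold splitTerm
    simp [Word.spurPlaquette, Word.siteAt, Word.endpoint, hs3, hμν']
  have h4 : splitTerm ρ s x μ U (Word.spurPlaquette μ ν) 4 = 0 := by
    unfold splitTerm
    simp [Word.spurPlaquette, Word.siteAt, Word.endpoint, hμν.symm]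
  have h5 : splitTerm ρ s x μ U (Word.spurPlaquette μ ν) 5 =
      -(((N : ℂ) - s / N) * (ρ (wordHolonomy U x (Word.spurPlaquette μ ν))).trace) := by
    unfold splitTerm
    simp only [Word.spurPlaquette, List.getElem?_cons_succ, List.getElem?_cons_zero, Word.siteAt, List.take,
      Word.endpoint_cons, Word.endpoint_nil, Step.apply_fwd, Step.apply_bwd, Step.edge_bwd, hs5, if_true,
      Step.isFwd_bwd, Bool.false_eq_true, if_false, List.drop, wordHolonomy_nil, map_one, Matrix.trace_one,
      Fintype.card_fin]
    ring
  rw [h0, h1, h2, h3, h4, h5]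
  ring

variable [TopologicalSpace G] [IsTopologicalGroup G] [CompactSpace G] [MeasurableSpace G] [BorelSpace G]
  (r : LatticeRep G)

/-- **The plaquette row (1eq), any dimension, abstract form**: for the word `P = +μ +ν −μ −ν` and the edge `(x, μ)`,
`(N − s/N)·E[tr ρ(U_P)] + (β/2)·Σ_{ν'≠μ,ε} E[plaqTerm_{ν',ε}] = 0` (`L ≥ 2`). [folklore] -/
theorem loopEquation_plaquette [NeZero L] (hL : (1 : ZMod L) ≠ 0) (β : ℝ) (x : Site d L) {μ ν : Fin d}
    (hμν : μ ≠ ν) (s : ℂ) (hP : ∀ i j : Fin r.N, SDPair r β x μ x (Word.plaquette μ ν) (unitDir s i j)) :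
    ((r.N : ℂ) - s / r.N) * ∫ U, (r.ρ (wordHolonomy U x (Word.plaquette μ ν))).trace
        ∂(wilsonMeasure (d := d) (L := L) r.ρ β) +
      (β / 2 : ℂ) * ∑ ν' ∈ Finset.univ.erase μ, ∑ ε : Bool,
        ∫ U, plaqTerm r.ρ s x μ U (Word.plaquette μ ν) ν' ε ∂(wilsonMeasure (d := d) (L := L) r.ρ β) = 0 := by
  have h := loopEquation_of_sdPair r β x μ s (Word.plaquette μ ν) (endpoint_plaquette x μ ν) hP
  rw [← integral_finsetSum _ fun k _ => integrable_of_continuous r β (continuous_splitTerm r s x μ _ k)] at h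
  simp_rw [sum_splitTerm_plaquette r.ρ hL s x hμν] at h
  rwa [integral_const_mul] at h

/-- **The spur-plaquette row (2eq), any dimension, abstract form**: for `w = +μ +μ +ν −μ −ν −μ` and the edge `(x, μ)`
the split terms cancel and `(β/2)·Σ_{ν'≠μ,ε} E[plaqTerm_{ν',ε}] = 0` (`L ≥ 2`). [folklore] -/
theorem loopEquation_spurPlaquette [NeZero L] (hL : (1 : ZMod L) ≠ 0) (β : ℝ) (x : Site d L) {μ ν : Fin d}
    (hμν : μ ≠ ν) (s : ℂ) (hP : ∀ i j : Fin r.N, SDPair r β x μ x (Word.spurPlaquette μ ν) (unitDir s i j)) :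
    (β / 2 : ℂ) * ∑ ν' ∈ Finset.univ.erase μ, ∑ ε : Bool,
        ∫ U, plaqTerm r.ρ s x μ U (Word.spurPlaquette μ ν) ν' ε ∂(wilsonMeasure (d := d) (L := L) r.ρ β) = 0 := by
  have h := loopEquation_of_sdPair r β x μ s (Word.spurPlaquette μ ν) (endpoint_spurPlaquette x μ ν) hP
  rw [← integral_finsetSum _ fun k _ => integrable_of_continuous r β (continuous_splitTerm r s x μ _ k)] at h
  simp_rw [sum_splitTerm_spurPlaquette r.ρ hL s x hμν] at h
  rwa [integral_zero, zero_add] at h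

end Instances

section ConcreteInstances

open Literature.MathematicalPhysics.QuantumLattice

/-- Unfolding lemma `fundamentalLatticeRep_ρ`: the representation field of the tree's `fundamentalLatticeRep`. [folklore] -/
@[simp] theorem fundamentalLatticeRep_ρ (N : ℕ) : (fundamentalLatticeRep N).ρ = fundamentalRep (Fin N) := rfl

/-- Unfolding lemma `unitaryFundamentalLatticeRep_ρ`. [folklore] -/
@[simp] theorem unitaryFundamentalLatticeRep_ρ (N : ℕ) :
    (unitaryFundamentalLatticeRep N).ρ = unitaryFundamentalRep (Fin N) ℂ := rfl

/-- In `d = 2` the only axis other than `0` is `1`. [folklore] -/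
theorem univ_erase_zero_fin_two : (Finset.univ : Finset (Fin 2)).erase 0 = {1} := by decide

/-- **For `g ∈ SU(2)` the trace is real** (`g₁₁ = conj g₀₀`, tree `su2_apply_11`). [folklore] -/
theorem star_trace_su_two (g : Matrix.specialUnitaryGroup (Fin 2) ℂ) :
    star (g : Matrix (Fin 2) (Fin 2) ℂ).trace = (g : Matrix (Fin 2) (Fin 2) ℂ).trace := by
  rw [Matrix.trace_fin_two, su2_apply_11, star_add, Complex.star_def, Complex.conj_conj, add_comm]

/-- `SU(2)`: `tr U⁻¹ = tr U` in the fundamental representation. [folklore] -/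
theorem trace_fundamentalRep_two_inv (g : Matrix.specialUnitaryGroup (Fin 2) ℂ) :
    (fundamentalRep (Fin 2) g⁻¹).trace = (fundamentalRep (Fin 2) g).trace := by
  rw [unitaryRep_inv_eq_conjTranspose _ fundamentalRep_mem_unitaryGroup, Matrix.trace_conjTranspose]
  exact star_trace_su_two g

/-- **`SU(2)`: the plaquette term has no double-trace part** (`tr U_{P̃⁻¹} = tr U_{P̃}` pointwise), so every `SU(2)`
row is single-trace: `plaqTerm = tr U_{w·P̃} − tr U_{w·P̃⁻¹}` (MM-DERIVATION §4, SU(2) bullet). [folklore] -/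
theorem plaqTerm_su_two (s : ℂ) (x : Site d L) (μ : Fin d) (U : GaugeConfig d L (Matrix.specialUnitaryGroup (Fin 2) ℂ))
    (w : Word d) (ν : Fin d) (ε : Bool) :
    plaqTerm (fundamentalRep (Fin 2)) s x μ U w ν ε =
      (fundamentalRep (Fin 2) (wordHolonomy U x (w ++ plaqWord μ ν ε))).trace -
        (fundamentalRep (Fin 2) (wordHolonomy U x (w ++ (plaqWord μ ν ε).reverse))).trace := by
  unfold plaqTerm
  have h := wordHolonomy_reverse U x (plaqWord μ ν ε)
  rw [endpoint_plaqWord] at h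
  rw [h, trace_fundamentalRep_two_inv, sub_self, mul_zero, mul_zero, sub_zero]

variable {L : ℕ} [NeZero L]

/-- **(1eq) for `SU(N)`, `d = 2`** (any `N`, `L ≥ 2`, real `β = β_std/N`): with `P = +0 +1 −0 −1` at `x`, `e = (x, 0)`,
`(N − 1/N)·E[tr U_P] + (β/2)·Σ_{ε=±} E[plaqTerm_{1,ε}] = 0`, where `plaqTerm_{1,+} = tr U_{P·P} − tr U_{P·P⁻¹} −
(1/N) tr U_P (tr U_P − tr U_{P⁻¹})` and `plaqTerm_{1,−} = tr U_{P·Q} − tr U_{P·Q⁻¹} − (1/N) tr U_P (tr U_Q − tr U_{Q⁻¹})`,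
`Q = +0 −1 −0 +1`.  Dividing by `N²`: `(1 − 1/N²)u + (1/λ)(D − 1 + B − R − dt) = 0` — KZ2024 (1eq) / GLYZ's toy
equation for `SU(N)` (MM-DERIVATION §5, §7; `dt` the double-trace variables, absent for `SU(2)`). [folklore] -/
theorem oneEq_specialUnitaryGroup (N : ℕ) (hL : (1 : ZMod L) ≠ 0) (β : ℝ) (x : Site 2 L) :
    ((N : ℂ) - 1 / N) * ∫ U, (fundamentalRep (Fin N) (wordHolonomy U x (Word.plaquette 0 1))).trace
        ∂(wilsonMeasure (d := 2) (L := L) (fundamentalRep (Fin N)) β) +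
      (β / 2 : ℂ) * ∑ ε : Bool, ∫ U, plaqTerm (fundamentalRep (Fin N)) 1 x 0 U (Word.plaquette 0 1) 1 ε
        ∂(wilsonMeasure (d := 2) (L := L) (fundamentalRep (Fin N)) β) = 0 := by
  have h := loopEquation_plaquette (fundamentalLatticeRep N) hL β x (μ := 0) (ν := 1) (by decide) 1
    fun i j => sdPair_specialUnitaryGroup N β x 0 x _ _ (trace_unitDir_one i j)
  rw [univ_erase_zero_fin_two, Finset.sum_singleton] at h
  exact h

/-- **(1eq) for `U(N)`, `d = 2`** (`s = 0`): `N·E[tr U_P] + (β/2)·Σ_ε E[tr U_{P·P̃_ε} − tr U_{P·P̃_ε⁻¹}] = 0`, i.e.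
`u + (1/λ)(D − 1 + B − R) = 0` after dividing by `N²` — N-free (KZ2024's `U(N)` row, MM-DERIVATION §4). [folklore] -/
theorem oneEq_unitaryGroup (N : ℕ) (hL : (1 : ZMod L) ≠ 0) (β : ℝ) (x : Site 2 L) :
    (N : ℂ) * ∫ U, (unitaryFundamentalRep (Fin N) ℂ (wordHolonomy U x (Word.plaquette 0 1))).trace
        ∂(wilsonMeasure (d := 2) (L := L) (unitaryFundamentalRep (Fin N) ℂ) β) +
      (β / 2 : ℂ) * ∑ ε : Bool, ∫ U, plaqTerm (unitaryFundamentalRep (Fin N) ℂ) 0 x 0 U (Word.plaquette 0 1) 1 ε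
        ∂(wilsonMeasure (d := 2) (L := L) (unitaryFundamentalRep (Fin N) ℂ) β) = 0 := by
  have h := loopEquation_plaquette (unitaryFundamentalLatticeRep N) hL β x (μ := 0) (ν := 1) (by decide) 0
    fun i j => sdPair_unitaryGroup N β x 0 x _ _
  rw [univ_erase_zero_fin_two, Finset.sum_singleton, zero_div, sub_zero] at h
  exact h

/-- **(2eq) for `SU(N)`, `d = 2`**: for `w = +0 +0 +1 −0 −1 −0` and `e = (x, 0)`, `(β/2)·Σ_ε E[plaqTerm_{1,ε}] = 0`
(KZ2024's backtrack-type equation `R − B − F₊ + F₋ = 0` for `SU(2)`/`U(N)`; cell F0-SPEC.md §3). [folklore] -/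
theorem twoEq_specialUnitaryGroup (N : ℕ) (hL : (1 : ZMod L) ≠ 0) (β : ℝ) (x : Site 2 L) :
    (β / 2 : ℂ) * ∑ ε : Bool, ∫ U, plaqTerm (fundamentalRep (Fin N)) 1 x 0 U (Word.spurPlaquette 0 1) 1 ε
        ∂(wilsonMeasure (d := 2) (L := L) (fundamentalRep (Fin N)) β) = 0 := by
  have h := loopEquation_spurPlaquette (fundamentalLatticeRep N) hL β x (μ := 0) (ν := 1) (by decide) 1
    fun i j => sdPair_specialUnitaryGroup N β x 0 x _ _ (trace_unitDir_one i j)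
  rw [univ_erase_zero_fin_two, Finset.sum_singleton] at h
  exact h

/-- **(2eq) for `U(N)`, `d = 2`**. [folklore] -/
theorem twoEq_unitaryGroup (N : ℕ) (hL : (1 : ZMod L) ≠ 0) (β : ℝ) (x : Site 2 L) :
    (β / 2 : ℂ) * ∑ ε : Bool, ∫ U, plaqTerm (unitaryFundamentalRep (Fin N) ℂ) 0 x 0 U (Word.spurPlaquette 0 1) 1 ε
        ∂(wilsonMeasure (d := 2) (L := L) (unitaryFundamentalRep (Fin N) ℂ) β) = 0 := by
  have h := loopEquation_spurPlaquette (unitaryFundamentalLatticeRep N) hL β x (μ := 0) (ν := 1) (by decide) 0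
    fun i j => sdPair_unitaryGroup N β x 0 x _ _
  rw [univ_erase_zero_fin_two, Finset.sum_singleton] at h
  exact h


/-- The expectation of the constant `tr 1 = N`... generally of a constant: Wilson's measure is a probability measure.
[folklore] -/
theorem integral_const_wilson {G : Type} [Group G] [TopologicalSpace G] [IsTopologicalGroup G] [CompactSpace G]
    [MeasurableSpace G] [BorelSpace G] (r : LatticeRep G) (β : ℝ) (c : ℂ) :
    ∫ _U, c ∂(wilsonMeasure (d := d) (L := L) r.ρ β) = c := by
  haveI := isProbabilityMeasure_wilsonMeasure (d := d) (L := L) r.ρ r.continuous β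
  simp

/-- **(1eq) for `SU(2)`, `d = 2`, fully explicit (single traces only).**  With `P = +0 +1 −0 −1`, `Q = +0 −1 −0 +1` at
`x` and `E = ∫ · d(wilsonMeasure ρ β)`, `ρ` the fundamental representation of `SU(2)`, `β = β_std/2`, `L ≥ 2`:
`(3/2)·E[tr U_P] + (β/2)·((E[tr U_{P·P}] − 2) + (E[tr U_{P·Q}] − E[tr U_{P·Q⁻¹}])) = 0`.
In the loop variables of KZ2024's six-variable system (`u = E[½tr U_P]`, `D = ½E tr U_{P·P}`, `B = ½E tr U_{P·Q}`
(the "bowtie"), `R = ½E tr U_{P·Q⁻¹}` (the `1×2` rectangle after the cyclic backtrack reduction), `λ = 4/β`) this is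
`(3/4)λu + D − 1 + B − R = 0` — the printed (1eq), whose SDP optimum with (2eq) is `0.75755` at `λ = 2` (cell STEP-0
row S0-1; F0-SPEC.md, SIXVAR-S01.md). [folklore] -/
theorem oneEq_su_two (hL : (1 : ZMod L) ≠ 0) (β : ℝ) (x : Site 2 L) :
    (3 / 2 : ℂ) * (∫ U, (fundamentalRep (Fin 2) (wordHolonomy U x (Word.plaquette 0 1))).trace
        ∂(wilsonMeasure (d := 2) (L := L) (fundamentalRep (Fin 2)) β)) +
      (β / 2 : ℂ) *
        ((∫ U, (fundamentalRep (Fin 2) (wordHolonomy U x (Word.plaquette 0 1 ++ Word.plaquette 0 1))).trace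
            ∂(wilsonMeasure (d := 2) (L := L) (fundamentalRep (Fin 2)) β)) - 2 +
          ((∫ U, (fundamentalRep (Fin 2) (wordHolonomy U x (Word.plaquette 0 1 ++ plaqWord 0 1 false))).trace
              ∂(wilsonMeasure (d := 2) (L := L) (fundamentalRep (Fin 2)) β)) -
            (∫ U, (fundamentalRep (Fin 2)
                (wordHolonomy U x (Word.plaquette 0 1 ++ (plaqWord 0 1 false).reverse))).trace
              ∂(wilsonMeasure (d := 2) (L := L) (fundamentalRep (Fin 2)) β)))) = 0 := by
  have h := oneEq_specialUnitaryGroup (L := L) 2 hL β x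
  simp_rw [Fintype.sum_bool, plaqTerm_su_two] at h
  have hi : ∀ w : Word 2, Integrable (fun U : GaugeConfig 2 L (Matrix.specialUnitaryGroup (Fin 2) ℂ) =>
      (fundamentalRep (Fin 2) (wordHolonomy U x w)).trace) (wilsonMeasure (d := 2) (L := L) (fundamentalRep (Fin 2)) β) :=
    fun w => integrable_of_continuous (fundamentalLatticeRep 2) β (continuous_trace_wordHolonomy (fundamentalLatticeRep 2) x w)
  rw [integral_sub (hi _) (hi _), integral_sub (hi _) (hi _)] at h
  have h1 : ∫ U, (fundamentalRep (Fin 2)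
      (wordHolonomy U x (Word.plaquette 0 1 ++ (plaqWord 0 1 true).reverse))).trace
        ∂(wilsonMeasure (d := 2) (L := L) (fundamentalRep (Fin 2)) β) = 2 := by
    simp_rw [plaqWord_true, wordHolonomy_append_reverse, map_one, Matrix.trace_one, Fintype.card_fin]
    exact integral_const_wilson (fundamentalLatticeRep 2) β 2
  rw [h1, plaqWord_true] at h
  convert h using 2
  push_cast
  ring


/-- **`SU(2)`: the trace in the fundamental representation is real** (as a complex number). [folklore] -/
theorem trace_su_two_eq_ofReal (g : Matrix.specialUnitaryGroup (Fin 2) ℂ) :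
    (fundamentalRep (Fin 2) g).trace = (((fundamentalRep (Fin 2) g).trace.re : ℝ) : ℂ) := by
  rw [fundamentalRep_apply]
  exact (Complex.conj_eq_iff_re.1 (star_trace_su_two g)).symm

/-- `SU(2)`: the complex expectation of `tr U_w` is twice the (real) loop variable expectation
`E[(1/2) Re tr U_w]` (the cell's `wordLoop (suRep 2) x w`, written out). [folklore] -/
theorem integral_trace_su_two (β : ℝ) (x : Site d L) (w : Word d) :
    ∫ U, (fundamentalRep (Fin 2) (wordHolonomy U x w)).trace
        ∂(wilsonMeasure (d := d) (L := L) (fundamentalRep (Fin 2)) β) =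
      (((2 : ℝ) * wilsonExpectation (d := d) (L := L) (fundamentalRep (Fin 2)) β
        (fun U => ((2 : ℕ) : ℝ)⁻¹ * ((fundamentalRep (Fin 2) (wordHolonomy U x w)).trace).re) : ℝ) : ℂ) := by
  unfold wilsonExpectation
  rw [integral_const_mul, ← mul_assoc, show (2 : ℝ) * ((2 : ℕ) : ℝ)⁻¹ = 1 by norm_num, one_mul,
    ← integral_complex_ofReal]
  exact integral_congr_ae (ae_of_all _ fun U => trace_su_two_eq_ofReal _)

/-- **(1eq) for `SU(2)`, `d = 2`, in the cell's real loop variables** `E_w := ⟨(1/2) Re tr U_w⟩_β`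
(`= wilsonExpectation (suRep 2) β (wordLoop (suRep 2) x w)` of `GaugeBoot/WordLoop.lean`, written out):
`3·E_P + β·(E_{P·P} − 1 + E_{P·Q} − E_{P·Q⁻¹}) = 0` (`β = β_std/2`, `L ≥ 2`).  At `β_std = 4` (`β = 2`, `λ = 2`):
`−1 + (3/2)u + D + B − R = 0`, the hypothesis `h1eq` of lean1's kernel replay of certificate C1. [folklore] -/
theorem oneEq_su_two_real (hL : (1 : ZMod L) ≠ 0) (β : ℝ) (x : Site 2 L) :
    3 * wilsonExpectation (d := 2) (L := L) (fundamentalRep (Fin 2)) β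
        (fun U => ((2 : ℕ) : ℝ)⁻¹ * ((fundamentalRep (Fin 2) (wordHolonomy U x (Word.plaquette 0 1))).trace).re) +
      β * (wilsonExpectation (d := 2) (L := L) (fundamentalRep (Fin 2)) β
          (fun U => ((2 : ℕ) : ℝ)⁻¹ *
            ((fundamentalRep (Fin 2) (wordHolonomy U x (Word.plaquette 0 1 ++ Word.plaquette 0 1))).trace).re) - 1 +
        wilsonExpectation (d := 2) (L := L) (fundamentalRep (Fin 2)) β
          (fun U => ((2 : ℕ) : ℝ)⁻¹ *
            ((fundamentalRep (Fin 2) (wordHolonomy U x (Word.plaquette 0 1 ++ plaqWord 0 1 false))).trace).re) -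
        wilsonExpectation (d := 2) (L := L) (fundamentalRep (Fin 2)) β
          (fun U => ((2 : ℕ) : ℝ)⁻¹ * ((fundamentalRep (Fin 2)
            (wordHolonomy U x (Word.plaquette 0 1 ++ (plaqWord 0 1 false).reverse))).trace).re)) = 0 := by
  have h := oneEq_su_two (L := L) hL β x
  simp only [integral_trace_su_two] at h
  apply Complex.ofReal_injective
  push_cast at h ⊢
  linear_combination h

/-- **(2eq) for `SU(2)`, `d = 2`, in real loop variables**: with `w = +0 +0 +1 −0 −1 −0`, `P = +0 +1 −0 −1`,
`Q = +0 −1 −0 +1`: `β·(E_{w·P} − E_{w·P⁻¹} + E_{w·Q} − E_{w·Q⁻¹}) = 0` — after cyclic/backtrack reduction and lattice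
symmetry the four words are the classes `R, B, F₊, F₋` of the six-variable system (`R − B − F₊ + F₋ = 0`, `h2eq`).
[folklore] -/
theorem twoEq_su_two_real (hL : (1 : ZMod L) ≠ 0) (β : ℝ) (x : Site 2 L) :
    β * (wilsonExpectation (d := 2) (L := L) (fundamentalRep (Fin 2)) β
          (fun U => ((2 : ℕ) : ℝ)⁻¹ *
            ((fundamentalRep (Fin 2) (wordHolonomy U x (Word.spurPlaquette 0 1 ++ plaqWord 0 1 true))).trace).re) -
        wilsonExpectation (d := 2) (L := L) (fundamentalRep (Fin 2)) β
          (fun U => ((2 : ℕ) : ℝ)⁻¹ * ((fundamentalRep (Fin 2)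
            (wordHolonomy U x (Word.spurPlaquette 0 1 ++ (plaqWord 0 1 true).reverse))).trace).re) +
        (wilsonExpectation (d := 2) (L := L) (fundamentalRep (Fin 2)) β
          (fun U => ((2 : ℕ) : ℝ)⁻¹ *
            ((fundamentalRep (Fin 2) (wordHolonomy U x (Word.spurPlaquette 0 1 ++ plaqWord 0 1 false))).trace).re) -
        wilsonExpectation (d := 2) (L := L) (fundamentalRep (Fin 2)) β
          (fun U => ((2 : ℕ) : ℝ)⁻¹ * ((fundamentalRep (Fin 2)
            (wordHolonomy U x (Word.spurPlaquette 0 1 ++ (plaqWord 0 1 false).reverse))).trace).re))) = 0 := by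
  have h := twoEq_specialUnitaryGroup (L := L) 2 hL β x
  simp_rw [Fintype.sum_bool, plaqTerm_su_two] at h
  have hi : ∀ w : Word 2, Integrable (fun U : GaugeConfig 2 L (Matrix.specialUnitaryGroup (Fin 2) ℂ) =>
      (fundamentalRep (Fin 2) (wordHolonomy U x w)).trace) (wilsonMeasure (d := 2) (L := L) (fundamentalRep (Fin 2)) β) :=
    fun w => integrable_of_continuous (fundamentalLatticeRep 2) β
      (continuous_trace_wordHolonomy (fundamentalLatticeRep 2) x w)
  rw [integral_sub (hi _) (hi _), integral_sub (hi _) (hi _)] at h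
  simp only [integral_trace_su_two] at h
  apply Complex.ofReal_injective
  push_cast at h ⊢
  linear_combination h

end ConcreteInstances

end Summit.QuantumFields.GaugeBoot

end
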